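/-
Copyright (c) 2026 the pub-hodgecm-mathlib formalisation cell (harness21).  R90-TF SLAB, section S10 (Rogawski 1990, Ch. 13.8), prover R90-C138-p01 (g0):
DEAL #63 (ii) (dealer R90-C138-plan (g3), 2026-09-05T02:56:19Z) — the block-D letter of ★ p864804 `realiseH₂_of_letters` PAID BY NAME over ★ p864731 (p06)
`exists_flathBlockH`; h413 = `stmt-HodgeConjecture-24833`, route `HCCMUnconditional`.
-/
import Summits.HodgeConjecture.HodgeConjecture.Theorems.R90S10FlathBlockH                  -- ★ p864731 (p06, DEAL #43): `exists_flathBlockH` (Flath on `H` at the standard levels)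
import Summits.HodgeConjecture.HodgeConjecture.Theorems.R90S10FrozenDatumTwoPlaceDefs      -- ★ C2 carriers + the context tokens of ★ p864804's binder `hD` (import closure of the letter)
import HarnessLib

/-!
# R90-TF ∕ S10 — `flathBlockD_of_exists_flathBlockH`: the block-D letter of the A2a₂ payer skeleton, BY NAME

Cell hodgecm-mathlib, slab R90-TF, section S10 = [Rogawski1990] §13.8 (p. 218 L22–L28), crux item h413 = `stmt-HodgeConjecture-24833`; kernel lane
`--kind proof --supports stmt-HodgeConjecture-24833 --as helper`; ONE THEOREM; no Lines import.

The statement is the binder type of `hD` in ★ p864804 `Theorems/R90S10RealiseH2OfLetters.lean :: realiseH₂_of_letters` (:227–:252) BYTE FOR BYTE (same generator): for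
every context of ★ `S10HDatum` at `v`, local classes `ρ₂` (admissible, spherical off `v`), a smooth character family `χθ` trivial on `U(Φ₁)(𝒪_w)` off `v`, the line
`θ = (⟦ℂ_{χθ w}⟧)_w` and the label `πSt = ρ_{2,v} ⊠ χθ_v`, the Flath block of `ρ = ρ₂ ⊠ θ` on `H(𝔸_f)` at the standard levels EXISTS — restricted tensor product with
bad set `{v}`, spherical lines off `v`, admissible factors, factor links, `Tr πSt = Tr ρ_v`.  PROOF: ★ `exists_flathBlockH` (p06) gives exactly this with the
`U(Φ₁)`-factor link stated for `⟦ℂ_{χθ w}⟧`; rewrite by `θ w = ⟦ℂ_{χθ w}⟧` (AUDIT S10#92 (a): «3 cosmetic opcodes»).  So typ3's A ED. 10 pays the sub-socket of block D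
by `flathBlockD_of_exists_flathBlockH` — no S-layer socket for D.

HONEST LABEL: block D of A2a₂ is in house (★ p864731 + this adapter); the other letters (E′, A, B, C, F, T2) are untouched; HC_CM is proved only modulo the 7 printed
citations (2 remaining named inputs: hLiu418 = `stmt-HodgeConjecture-24832`, h413 = `stmt-HodgeConjecture-24833`) until rung 0 closes; REL ≠ ★ ≠ BUILT.

## References
* [Rogawski1990] J. Rogawski, *Automorphic Representations of Unitary Groups in Three Variables*, Ann. of Math. Stud. 123 (1990), §13.8 p. 218 L22–L28; §4.9 Prop. 4.9.1 p. 55.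
* [FlathCorvallis1979] D. Flath, *Decomposition of representations into tensor products*, Proc. Sympos. Pure Math. 33.1 (1979), Thm. 3–4.
-/

set_option autoImplicit false
set_option linter.dupNamespace false

noncomputable section

open scoped RestrictedProduct Matrix MatrixGroups InnerProductSpace
open Filter MeasureTheory NumberField IsDedekindDomain CompactlySupported
open Literature.NumberTheory.Rogawski1990 Literature.NumberTheory.Automorphic Literature.NumberTheory.Automorphic.UnitaryGroup
open Literature.NumberTheory.Automorphic.UnitaryGroup.CotangentForms Literature.NumberTheory.GaloisRepresentations
open Literature.NumberTheory.Automorphic.Arthur2013.Leaves.TECR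
open Summit.HodgeConjecture.HodgeConjecture.Cruxes.H413.F0P3GlobalPacketDiscrete (cmOccursInDiscreteSpectrum)
open Summit.HodgeConjecture.HodgeConjecture.Cruxes.H413.K2E1TraceFormulaBeta
open Summit.HodgeConjecture.HodgeConjecture.Cruxes.H413.K2E1SpectralTermsDiscreteHalf

namespace Summit.HodgeConjecture.HodgeConjecture.R90.S10

/-- **Block D of `realiseH₂_of_letters`, BY NAME** — the binder type of `hD` in ★ p864804 (bytes identical), proved by ★ `exists_flathBlockH` (p06) after rewriting the
`U(Φ₁)`-factor link along `θ w = ⟦ℂ_{χθ w}⟧`. [cite: Rogawski1990, §13.8 p. 218 L22–L28; §4.9 Prop. 4.9.1 p. 55] [cite: FlathCorvallis1979, Thm. 3–4] -/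
theorem flathBlockD_of_exists_flathBlockH :
    ∀ (L : Type) [Field L] [NumberField L] [IsCMField L] [DecidableEq (Pl L)] (μ : HeckeCharacter L) (v : Pl L)
      [MeasurableSpace (HLoc L v)] [BorelSpace (HLoc L v)] [MeasurableSpace (Gqs L v)] [BorelSpace (Gqs L v)]
      (νHv : Measure (HLoc L v)) (νQv : Measure (Gqs L v)) [νHv.IsHaarMeasure] [νHv.IsMulRightInvariant] [νQv.IsHaarMeasure] [νQv.IsMulRightInvariant]
      [∀ a : HLoc L v, MeasurableSpace (HLoc L v ⧸ Subgroup.centralizer ({a} : Set (HLoc L v)))]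
      [∀ a : HLoc L v, BorelSpace (HLoc L v ⧸ Subgroup.centralizer ({a} : Set (HLoc L v)))]
      [∀ γ : Gqs L v, MeasurableSpace (Gqs L v ⧸ Subgroup.centralizer ({γ} : Set (Gqs L v)))]
      [∀ γ : Gqs L v, BorelSpace (Gqs L v ⧸ Subgroup.centralizer ({γ} : Set (Gqs L v)))]
      (mHv : OrbitalMeasureFamily (HLoc L v)) (mQv : OrbitalMeasureFamily (Gqs L v)) (πSt : IrrClass (HLoc L v))
      [MeasurableSpace (G3 L).Adelic] [BorelSpace (G3 L).Adelic] [MeasurableSpace (H2 L).Adelic] [BorelSpace (H2 L).Adelic]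
      [MeasurableSpace (GArch L)] [BorelSpace (GArch L)] [MeasurableSpace (HArch L)] [BorelSpace (HArch L)]
      [MeasurableSpace (H1Loc L v)] [BorelSpace (H1Loc L v)] [MeasurableSpace (H1Arch L)] [BorelSpace (H1Arch L)]
      [MeasurableSpace (H1 L).Adelic] [BorelSpace (H1 L).Adelic],
      ∀ (ρ₂ : ∀ w : Pl L, IrrClass (H2Loc L w)), (∀ w : Pl L, (ρ₂ w).IsAdmissible) →
      (∀ w : Pl L, w ≠ v → (ρ₂ w).IsSpherical (cmLocalIntegralLevel L 2 (Matrix.of fun i j : Fin 2 => if i.val + j.val + 1 = 2 then (1 : L) else 0) w)) →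
      ∀ (χθ : ∀ w : Pl L, H1Loc L w →* ℂˣ) (hχθ : ∀ w : Pl L, IsOpen ((χθ w).ker : Set (H1Loc L w))),
      (∀ w : Pl L, w ≠ v → ∀ k ∈ (cmLocalIntegralLevel L 1 (Matrix.of fun i j : Fin 1 => if i.val + j.val + 1 = 1 then (1 : L) else 0) w), χθ w k = 1) →
      ∀ (θ : ∀ w : Pl L, IrrClass (H1Loc L w)), (∀ w : Pl L, θ w = IrrClass.mk (SmoothIrrep.ofChar (χθ w) (hχθ w))) →
      πSt = IrrClass.boxChar (χθ v) (hχθ v) (ρ₂ v) →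
      ∀ [Fact (∀ w, IsOpen (((cmLocalIntegralLevel L 2 (Matrix.of fun i j : Fin 2 => if i.val + j.val + 1 = 2 then (1 : L) else 0) w).prod (cmLocalIntegralLevel L 1 (Matrix.of fun i j : Fin 1 => if i.val + j.val + 1 = 1 then (1 : L) else 0) w)) : Set (HLoc L w)))],
      ∃ (V : Pl L → Type) (_ : ∀ w, AddCommGroup (V w)) (_ : ∀ w, Module ℂ (V w)) (ρ : ∀ w, Representation ℂ (HLoc L w) (V w)) (x₀ : ∀ w, V w) (W : Type) (_ : AddCommGroup W) (_ : Module ℂ W) (σH : Representation ℂ (Πʳ w : Pl L, [HLoc L w, ((cmLocalIntegralLevel L 2 (Matrix.of fun i j : Fin 2 => if i.val + j.val + 1 = 2 then (1 : L) else 0) w).prod (cmLocalIntegralLevel L 1 (Matrix.of fun i j : Fin 1 => if i.val + j.val + 1 = 1 then (1 : L) else 0) w))]) W) (hx₀ : ∀ᶠ w in cofinite, x₀ w ∈ (ρ w).fixedPoints (((cmLocalIntegralLevel L 2 (Matrix.of fun i j : Fin 2 => if i.val + j.val + 1 = 2 then (1 : L) else 0) w).prod (cmLocalIntegralLevel L 1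 (Matrix.of fun i j : Fin 1 => if i.val + j.val + 1 = 1 then (1 : L) else 0) w)))) (j : RestrictedFamily V x₀ → W),
        IsRestrictedTensorProductRep ρ σH hx₀ j ({v} : Finset (Pl L)) ∧
        (∀ w, w ≠ v → (ρ w).fixedPoints (((cmLocalIntegralLevel L 2 (Matrix.of fun i j : Fin 2 => if i.val + j.val + 1 = 2 then (1 : L) else 0) w).prod (cmLocalIntegralLevel L 1 (Matrix.of fun i j : Fin 1 => if i.val + j.val + 1 = 1 then (1 : L) else 0) w))) = ℂ ∙ x₀ w) ∧
        (∀ w, (ρ w).IsAdmissible) ∧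
        (∀ w, (ρ₂ w).IsConstituentOf ((ρ w).comp (MonoidHom.inl _ _))) ∧
        (∀ w, (θ w).IsConstituentOf ((ρ w).comp (MonoidHom.inr _ _))) ∧
        πSt.smoothTrace νHv = (ρ v).smoothTrace νHv := by
  intro L _ _ _ _ μ v _ _ _ _ νHv νQv _ _ _ _ _ _ _ _ mHv mQv πSt _ _ _ _ _ _ _ _ _ _ _ _ _ _ ρ₂ hadm₂ hsph₂ χθ hχθ hχθK θ hθχ hπSt _
  obtain ⟨V, acV, mdV, ρ, x₀, W, acW, mdW, σH, hx₀, j, hσH, hline, hadm, hfac₂, hfac₁, hpin⟩ :=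
    exists_flathBlockH L v ρ₂ hadm₂ hsph₂ χθ hχθ hχθK πSt hπSt νHv
  exact ⟨V, acV, mdV, ρ, x₀, W, acW, mdW, σH, hx₀, j, hσH, hline, hadm, hfac₂, fun w => by rw [hθχ w]; exact hfac₁ w, hpin⟩

end Summit.HodgeConjecture.HodgeConjecture.R90.S10

end
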